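import Summits.QuantumFields.BalabanUV.Beta.EriceFlowEnclosureB12AsPrintedHistoryContagionShiftFlowZeroTangentLimit

/-!
# Beta / EriceFlowEnclosureB12AsPrintedHistoryContagionShiftFlowZeroTangentSecondQuotient — ASYMPTOTIC FREEDOM IS CONTAGIOUS, part 79: THE SECOND-ORDER QUOTIENT IDENTITY AND
# ITS PERTURBATION ESTIMATE — ABSTRACT AND B-FREE, in the language of part 66.  Two linear memory equations `W_k = s_k − Σ_{p<k}Σ_j c_{p,j}v_{p+1+j}W_{p+1+j}` and
# `W̃_k = s̃_k − Σ_{p<k}Σ_j c̃_{p,j}ṽ_{p+1+j}W̃_{p+1+j}` under part 66's standing bounds (`|c|, |c̃| ≤ C_mθ^j`, `|v|, |ṽ| ≤ w∕2`, bounded solutions) and a number δ (in parts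
# 80–81: the tangent flows at two pins and the chart increment `δ̂ = 1∕ẽ² − 1∕e²`).  (§139) THE QUOTIENT `Q = (W̃ − W)∕δ` SOLVES A LINEAR MEMORY EQUATION WITH THE BASE
# KERNEL, EXACTLY: **`Q_k = ((s̃_k − s_k)∕δ − Σ_{p<k}Σ_j ((c̃ṽ − cv)_{p,j}∕δ)·W̃_{p+1+j}) − Σ_{p<k}Σ_j c_{p,j}v_{p+1+j}Q_{p+1+j}`** (row-wise `tsum` algebra).  (§140) Against
# DERIVED DATA `(c₁, v₁)` with `|c₁| ≤ C₁θ^j`, `|v₁| ≤ D₁w` and the DERIVED SOURCE `σ_k = −Σ_{p<k}Σ_j (c₁v + cv₁)_{p,j}W_{p+1+j}` (part 78): if the data slopes are close to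
# the derived data — `|(c̃ − c)∕δ − c₁| ≤ η_cθ^j`, `|ṽ − v| ≤ η_dw`, `|(ṽ − v)∕δ − v₁| ≤ η_vw`, `|W̃ − W| ≤ η_W` — then EVERY summand of the quotient's source is
# `ηθ^jw_{p+1+j}`-close to the derived one, `η = (η_c∕2 + C₁η_d + C_mη_v)M′ + (C₁∕2 + C_mD₁)η_W` (`secondIntegrand_sub_abs_le`: the four-term split
# `[((c̃−c)∕δ − c₁)ṽ + c₁(ṽ − v) + c((ṽ−v)∕δ − v₁)]W̃ + (c₁v + cv₁)(W̃ − W)`), so the sources are `ηS∕(1−θ)`-close AT EVERY SCALE (part 66's kernel lemma).  (§141) Hence,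
# for equal sources `s̃ = s`, ONE application of part 66's `fixedPoint_perturb` (same kernel, η = 0 there): **`|Q_k − V_k| ≤ (ηS∕(1−θ))∕(1 − C_mS∕(2(1−θ)))` FOR EVERY k**, V the
# bounded solution of the derived equation.  Part 80 feeds the four smallnesses from parts 69, 71, 77 and the C² shape, and lets ẽ → e
# (β-flow team, prover 1, unit `b2b-balaban-beta-bflow-p1`, gen 43; ROW AP-I·Uc × NODE U2)

HONEST FRAMING (page 1 of everything the β sub-cell writes): discharging `BetaPertH` makes Bałaban's UV stability UNCONDITIONAL — a
real constructive-QFT result; it is NOT the continuum limit and NOT the Clay problem.  HONEST DEPENDENCY (cell reorg 2026-08-19,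
verbatim): «continuum YM on T⁴ ⇐ BetaPertH ∧ nine spine estimates (0/9 proved); BetaPertH ⇐ (D1) ∧ (D4) ∧ CAP+tail; G-an2-4 gates
asym, D1 and NE2/3/4.»  THIS MODULE DISCHARGES NOTHING: [folklore] real analysis (row-wise `tsum` algebra, the triangle inequality, parts 66–67's kernel and perturbation
lemmas) — NO functional B, no flow, no solution appears; parts 66–67 BY NAME.  [I] = T. Bałaban, Commun. Math. Phys. **109** (1987) [Balaban1987RG1] prints the recursion
(0.20) p. 256 and Theorem 2 (0.31) p. 259 (STATED WITHOUT PROOF); nothing of this linear algebra is in [I] and nothing of Bałaban's β is asserted.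

WHAT THIS FILE PROVES (0 sorry, 0 def): §139 `quotient_bound`, **`secondQuotient_identity`**; §140 **`secondIntegrand_sub_abs_le`**, `secondIntegrand_summable`,
**`secondSource_sub_abs_le`**; §141 **`secondQuotient_sub_abs_le`**.  NOT CLAIMED: anything at flow level (part 80); anything about Bałaban's β; `BetaPertH`; the continuum
limit of the measures; Clay.
-/

namespace Summit.QuantumFields.BalabanUV.Beta.EriceFlowEnclosureB12AsPrintedHistoryContagionShiftFlowZeroTangentSecondQuotient

open Finset Filter Topology
open Summit.QuantumFields.BalabanUV.Beta.EriceFlowEnclosureB12AsPrintedHistoryContagionShiftFlowZeroTangent (row_summable_abs_le kernel_abs_le abs_term_le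
  term_summable fixedPoint_perturb)

noncomputable section

/-! ## §139 The quotient of two solutions solves a linear memory equation with the base kernel, exactly -/

/-- The quotient `(W̃_q − W_q)∕δ` of two bounded sequences is bounded (by `(M′ + M)∕|δ|`; trivially when δ = 0). [folklore] -/
theorem quotient_bound {M M' δ : ℝ} {W WW : ℕ → ℝ} (hWM : ∀ q, |W q| ≤ M) (hWWM : ∀ q, |WW q| ≤ M') (q : ℕ) :
    |(WW q - W q) / δ| ≤ (M' + M) / |δ| := by
  rw [abs_div]
  exact div_le_div_of_nonneg_right ((abs_sub _ _).trans (add_le_add (hWWM q) (hWM q))) (abs_nonneg _)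

/-- **THE SECOND-ORDER QUOTIENT IDENTITY.**  Two linear memory equations with data (c, v, s) and (c̃, ṽ, s̃) under part 66's standing bounds, bounded solutions W, W̃, and ANY
number δ.  THEN, EXACTLY, at every scale k:
**`(W̃_k − W_k)∕δ = ((s̃_k − s_k)∕δ − Σ_{p<k}Σ_j ((c̃_{p,j}ṽ_{p+1+j} − c_{p,j}v_{p+1+j})∕δ)·W̃_{p+1+j}) − Σ_{p<k}Σ_j c_{p,j}v_{p+1+j}·((W̃_{p+1+j} − W_{p+1+j})∕δ)`** — the
quotient solves the BASE equation (kernel (c, v)) with a source made of the data increments read against the second solution (`c̃ṽW̃ − cvW = (c̃ṽ − cv)W̃ + cv(W̃ − W)`,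
row by row; every row absolutely convergent). [folklore] -/
theorem secondQuotient_identity {Cm θ M M' δ : ℝ} {w : ℕ → ℝ} {c cc : ℕ → ℕ → ℝ} {v vv s ss W WW : ℕ → ℝ}
    (hCm : 0 ≤ Cm) (hθ0 : 0 ≤ θ) (hθ1 : θ < 1) (hwanti : ∀ {a b : ℕ}, a ≤ b → w b ≤ w a)
    (hc : ∀ p j, |c p j| ≤ Cm * θ ^ j) (hv : ∀ q, |v q| ≤ w q / 2) (hcc : ∀ p j, |cc p j| ≤ Cm * θ ^ j) (hvv : ∀ q, |vv q| ≤ w q / 2)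
    (hW : ∀ k, W k = s k - ∑ p ∈ range k, ∑' j, c p j * v (p + 1 + j) * W (p + 1 + j)) (hWM : ∀ q, |W q| ≤ M)
    (hWW : ∀ k, WW k = ss k - ∑ p ∈ range k, ∑' j, cc p j * vv (p + 1 + j) * WW (p + 1 + j)) (hWWM : ∀ q, |WW q| ≤ M') (k : ℕ) :
    (WW k - W k) / δ
      = ((ss k - s k) / δ - ∑ p ∈ range k, ∑' j, (cc p j * vv (p + 1 + j) - c p j * v (p + 1 + j)) / δ * WW (p + 1 + j))
        - ∑ p ∈ range k, ∑' j, c p j * v (p + 1 + j) * ((WW (p + 1 + j) - W (p + 1 + j)) / δ) := by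
  have hQM : ∀ q, |(WW q - W q) / δ| ≤ (M' + M) / |δ| := quotient_bound hWM hWWM
  have hA : ∀ p, Summable fun j => cc p j * vv (p + 1 + j) * WW (p + 1 + j) := term_summable hCm hθ0 hθ1 hwanti hcc hvv hWWM
  have hBr : ∀ p, Summable fun j => c p j * v (p + 1 + j) * W (p + 1 + j) := term_summable hCm hθ0 hθ1 hwanti hc hv hWM
  have hAB : ∀ p, Summable fun j => c p j * v (p + 1 + j) * WW (p + 1 + j) := term_summable hCm hθ0 hθ1 hwanti hc hv hWWM
  have hD : ∀ p, Summable fun j => c p j * v (p + 1 + j) * ((WW (p + 1 + j) - W (p + 1 + j)) / δ) :=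
    term_summable (W := fun q => (WW q - W q) / δ) hCm hθ0 hθ1 hwanti hc hv hQM
  have hC : ∀ p, Summable fun j => (cc p j * vv (p + 1 + j) - c p j * v (p + 1 + j)) / δ * WW (p + 1 + j) := fun p =>
    (((hA p).sub (hAB p)).div_const δ).congr fun j => by ring
  have hrow : ∀ p, (∑' j, cc p j * vv (p + 1 + j) * WW (p + 1 + j) - ∑' j, c p j * v (p + 1 + j) * W (p + 1 + j)) / δ
      = ∑' j, (cc p j * vv (p + 1 + j) - c p j * v (p + 1 + j)) / δ * WW (p + 1 + j)
        + ∑' j, c p j * v (p + 1 + j) * ((WW (p + 1 + j) - W (p + 1 + j)) / δ) := by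
    intro p
    rw [← (hA p).tsum_sub (hBr p), ← tsum_div_const, ← (hC p).tsum_add (hD p)]
    exact tsum_congr fun j => by ring
  rw [hWW k, hW k]
  have e1 : (ss k - ∑ p ∈ range k, ∑' j, cc p j * vv (p + 1 + j) * WW (p + 1 + j)
        - (s k - ∑ p ∈ range k, ∑' j, c p j * v (p + 1 + j) * W (p + 1 + j))) / δ
      = (ss k - s k) / δ - ∑ p ∈ range k, (∑' j, cc p j * vv (p + 1 + j) * WW (p + 1 + j) - ∑' j, c p j * v (p + 1 + j) * W (p + 1 + j)) / δ := by
    rw [← Finset.sum_div, Finset.sum_sub_distrib]; ring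
  rw [e1, Finset.sum_congr rfl fun p _ => hrow p, Finset.sum_add_distrib]
  ring

/-! ## §140 The source of the quotient against the derived source: every summand is `ηθ^j w`-close -/

/-- **THE FOUR-TERM SPLIT.**  Base data (c, v) and second data (c̃, ṽ) under the standing bounds, `|W̃| ≤ M′`; derived data `(c₁, v₁)` with `|c₁_{p,j}| ≤ C₁θ^j`, `|v₁_q| ≤ D₁w_q`;
smallnesses `|(c̃ − c)_{p,j}∕δ − c₁_{p,j}| ≤ η_cθ^j`, `|ṽ_q − v_q| ≤ η_dw_q`, `|(ṽ_q − v_q)∕δ − v₁_q| ≤ η_vw_q`, `|W̃_q − W_q| ≤ η_W`.  THEN for every p, j (q = p + 1 + j):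
**`|((c̃ṽ − cv)_{p,j}∕δ)W̃_q − (c₁v + cv₁)_{p,j}W_q| ≤ ηθ^jw_q`**, `η = (η_c∕2 + C₁η_d + C_mη_v)M′ + (C₁∕2 + C_mD₁)η_W`
(`E = [((c̃−c)∕δ − c₁)ṽ + c₁(ṽ − v) + c((ṽ−v)∕δ − v₁)]W̃ + (c₁v + cv₁)(W̃ − W)`). [folklore] -/
theorem secondIntegrand_sub_abs_le {Cm C₁ D₁ θ M' δ ηc ηd ηv ηW : ℝ} {w : ℕ → ℝ} {c cc c₁ : ℕ → ℕ → ℝ} {v vv v₁ W WW : ℕ → ℝ}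
    (hCm : 0 ≤ Cm) (hC₁ : 0 ≤ C₁) (hD₁ : 0 ≤ D₁) (hθ0 : 0 ≤ θ) (hw0 : ∀ q, 0 ≤ w q)
    (hc : ∀ p j, |c p j| ≤ Cm * θ ^ j) (hv : ∀ q, |v q| ≤ w q / 2) (hvv : ∀ q, |vv q| ≤ w q / 2)
    (hc₁ : ∀ p j, |c₁ p j| ≤ C₁ * θ ^ j) (hv₁ : ∀ q, |v₁ q| ≤ D₁ * w q) (hWWM : ∀ q, |WW q| ≤ M')
    (hηc0 : 0 ≤ ηc) (hηc : ∀ p j, |(cc p j - c p j) / δ - c₁ p j| ≤ ηc * θ ^ j) (hηd : ∀ q, |vv q - v q| ≤ ηd * w q)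
    (hηv : ∀ q, |(vv q - v q) / δ - v₁ q| ≤ ηv * w q) (hηW : ∀ q, |WW q - W q| ≤ ηW) (p j : ℕ) :
    |(cc p j * vv (p + 1 + j) - c p j * v (p + 1 + j)) / δ * WW (p + 1 + j) - (c₁ p j * v (p + 1 + j) + c p j * v₁ (p + 1 + j)) * W (p + 1 + j)|
      ≤ ((ηc / 2 + C₁ * ηd + Cm * ηv) * M' + (C₁ / 2 + Cm * D₁) * ηW) * θ ^ j * (w (p + 1 + j) * 1) := by
  have hθj : 0 ≤ θ ^ j := pow_nonneg hθ0 j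
  have hwq := hw0 (p + 1 + j)
  have hE : (cc p j * vv (p + 1 + j) - c p j * v (p + 1 + j)) / δ * WW (p + 1 + j) - (c₁ p j * v (p + 1 + j) + c p j * v₁ (p + 1 + j)) * W (p + 1 + j)
      = (((cc p j - c p j) / δ - c₁ p j) * vv (p + 1 + j) + c₁ p j * (vv (p + 1 + j) - v (p + 1 + j))
          + c p j * ((vv (p + 1 + j) - v (p + 1 + j)) / δ - v₁ (p + 1 + j))) * WW (p + 1 + j)
        + (c₁ p j * v (p + 1 + j) + c p j * v₁ (p + 1 + j)) * (WW (p + 1 + j) - W (p + 1 + j)) := by ring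
  rw [hE]
  have h1 : |((cc p j - c p j) / δ - c₁ p j) * vv (p + 1 + j)| ≤ ηc * θ ^ j * (w (p + 1 + j) / 2) := by
    rw [abs_mul]; exact mul_le_mul (hηc p j) (hvv _) (abs_nonneg _) (by positivity)
  have h2 : |c₁ p j * (vv (p + 1 + j) - v (p + 1 + j))| ≤ C₁ * θ ^ j * (ηd * w (p + 1 + j)) := by
    rw [abs_mul]; exact mul_le_mul (hc₁ p j) (hηd _) (abs_nonneg _) (by positivity)
  have h3 : |c p j * ((vv (p + 1 + j) - v (p + 1 + j)) / δ - v₁ (p + 1 + j))| ≤ Cm * θ ^ j * (ηv * w (p + 1 + j)) := by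
    rw [abs_mul]; exact mul_le_mul (hc p j) (hηv _) (abs_nonneg _) (by positivity)
  have h4 : |c₁ p j * v (p + 1 + j) + c p j * v₁ (p + 1 + j)| ≤ C₁ * θ ^ j * (w (p + 1 + j) / 2) + Cm * θ ^ j * (D₁ * w (p + 1 + j)) := by
    refine (abs_add_le _ _).trans (add_le_add ?_ ?_)
    · rw [abs_mul]; exact mul_le_mul (hc₁ p j) (hv _) (abs_nonneg _) (by positivity)
    · rw [abs_mul]; exact mul_le_mul (hc p j) (hv₁ _) (abs_nonneg _) (by positivity)
  have hX : |((cc p j - c p j) / δ - c₁ p j) * vv (p + 1 + j) + c₁ p j * (vv (p + 1 + j) - v (p + 1 + j))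
        + c p j * ((vv (p + 1 + j) - v (p + 1 + j)) / δ - v₁ (p + 1 + j))|
      ≤ ηc * θ ^ j * (w (p + 1 + j) / 2) + C₁ * θ ^ j * (ηd * w (p + 1 + j)) + Cm * θ ^ j * (ηv * w (p + 1 + j)) :=
    (abs_add_le _ _).trans (add_le_add ((abs_add_le _ _).trans (add_le_add h1 h2)) h3)
  have hXW : |(((cc p j - c p j) / δ - c₁ p j) * vv (p + 1 + j) + c₁ p j * (vv (p + 1 + j) - v (p + 1 + j))
        + c p j * ((vv (p + 1 + j) - v (p + 1 + j)) / δ - v₁ (p + 1 + j))) * WW (p + 1 + j)|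
      ≤ (ηc * θ ^ j * (w (p + 1 + j) / 2) + C₁ * θ ^ j * (ηd * w (p + 1 + j)) + Cm * θ ^ j * (ηv * w (p + 1 + j))) * M' := by
    rw [abs_mul]
    exact mul_le_mul hX (hWWM _) (abs_nonneg _) ((abs_nonneg _).trans hX)
  have hYW : |(c₁ p j * v (p + 1 + j) + c p j * v₁ (p + 1 + j)) * (WW (p + 1 + j) - W (p + 1 + j))|
      ≤ (C₁ * θ ^ j * (w (p + 1 + j) / 2) + Cm * θ ^ j * (D₁ * w (p + 1 + j))) * ηW := by
    rw [abs_mul]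
    exact mul_le_mul h4 (hηW _) (abs_nonneg _) (by positivity)
  calc _ ≤ (ηc * θ ^ j * (w (p + 1 + j) / 2) + C₁ * θ ^ j * (ηd * w (p + 1 + j)) + Cm * θ ^ j * (ηv * w (p + 1 + j))) * M'
        + (C₁ * θ ^ j * (w (p + 1 + j) / 2) + Cm * θ ^ j * (D₁ * w (p + 1 + j))) * ηW := (abs_add_le _ _).trans (add_le_add hXW hYW)
    _ = ((ηc / 2 + C₁ * ηd + Cm * ηv) * M' + (C₁ / 2 + Cm * D₁) * ηW) * θ ^ j * (w (p + 1 + j) * 1) := by ring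

/-- The rows of the derived source are summable (`|(c₁v + cv₁)_{p,j}W_q| ≤ (C₁∕2 + C_mD₁)M·θ^jw_q`). [folklore] -/
theorem secondIntegrand_summable {Cm C₁ D₁ θ M : ℝ} {w : ℕ → ℝ} {c c₁ : ℕ → ℕ → ℝ} {v v₁ W : ℕ → ℝ}
    (hCm : 0 ≤ Cm) (hC₁ : 0 ≤ C₁) (hD₁ : 0 ≤ D₁) (hθ0 : 0 ≤ θ) (hθ1 : θ < 1) (hw0 : ∀ q, 0 ≤ w q) (hwanti : ∀ {a b : ℕ}, a ≤ b → w b ≤ w a)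
    (hc : ∀ p j, |c p j| ≤ Cm * θ ^ j) (hv : ∀ q, |v q| ≤ w q / 2)
    (hc₁ : ∀ p j, |c₁ p j| ≤ C₁ * θ ^ j) (hv₁ : ∀ q, |v₁ q| ≤ D₁ * w q) (hWM : ∀ q, |W q| ≤ M) (p : ℕ) :
    Summable fun j => (c₁ p j * v (p + 1 + j) + c p j * v₁ (p + 1 + j)) * W (p + 1 + j) := by
  have hM : 0 ≤ M := (abs_nonneg _).trans (hWM 0)
  have hF : ∀ j, |(c₁ p j * v (p + 1 + j) + c p j * v₁ (p + 1 + j)) * W (p + 1 + j)| ≤ ((C₁ / 2 + Cm * D₁) * M) * θ ^ j * (w (p + 1 + j) * 1) := by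
    intro j
    have hθj : 0 ≤ θ ^ j := pow_nonneg hθ0 j
    have hwq := hw0 (p + 1 + j)
    have h4 : |c₁ p j * v (p + 1 + j) + c p j * v₁ (p + 1 + j)| ≤ C₁ * θ ^ j * (w (p + 1 + j) / 2) + Cm * θ ^ j * (D₁ * w (p + 1 + j)) := by
      refine (abs_add_le _ _).trans (add_le_add ?_ ?_)
      · rw [abs_mul]; exact mul_le_mul (hc₁ p j) (hv _) (abs_nonneg _) (by positivity)
      · rw [abs_mul]; exact mul_le_mul (hc p j) (hv₁ _) (abs_nonneg _) (by positivity)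
    rw [abs_mul]
    calc |c₁ p j * v (p + 1 + j) + c p j * v₁ (p + 1 + j)| * |W (p + 1 + j)|
        ≤ (C₁ * θ ^ j * (w (p + 1 + j) / 2) + Cm * θ ^ j * (D₁ * w (p + 1 + j))) * M := mul_le_mul h4 (hWM _) (abs_nonneg _) (by positivity)
      _ = ((C₁ / 2 + Cm * D₁) * M) * θ ^ j * (w (p + 1 + j) * 1) := by ring
  exact (row_summable_abs_le hθ0 hθ1 hwanti zero_le_one (by positivity) p hF).1

/-- **THE SOURCES ARE `ηS∕(1−θ)`-CLOSE AT EVERY SCALE**: under the hypotheses of `secondIntegrand_sub_abs_le` plus part 66's weight letters (w ≥ 0 antitone, partial sums ≤ S),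
`|c̃| ≤ C_mθ^j` and `|W| ≤ M`: for every k,
**`|(−Σ_{p<k}Σ_j ((c̃ṽ − cv)∕δ)W̃) − (−Σ_{p<k}Σ_j (c₁v + cv₁)W)| ≤ η·S∕(1−θ)`** (row-wise `tsum_sub`, then part 66's kernel lemma). [folklore] -/
theorem secondSource_sub_abs_le {Cm C₁ D₁ θ S M M' δ ηc ηd ηv ηW : ℝ} {w : ℕ → ℝ} {c cc c₁ : ℕ → ℕ → ℝ} {v vv v₁ W WW : ℕ → ℝ}
    (hCm : 0 ≤ Cm) (hC₁ : 0 ≤ C₁) (hD₁ : 0 ≤ D₁) (hθ0 : 0 ≤ θ) (hθ1 : θ < 1)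
    (hw0 : ∀ q, 0 ≤ w q) (hwanti : ∀ {a b : ℕ}, a ≤ b → w b ≤ w a) (hwS : ∀ m, ∑ q ∈ range (m + 1), w q ≤ S) (hM' : 0 ≤ M')
    (hc : ∀ p j, |c p j| ≤ Cm * θ ^ j) (hv : ∀ q, |v q| ≤ w q / 2) (hcc : ∀ p j, |cc p j| ≤ Cm * θ ^ j) (hvv : ∀ q, |vv q| ≤ w q / 2)
    (hc₁ : ∀ p j, |c₁ p j| ≤ C₁ * θ ^ j) (hv₁ : ∀ q, |v₁ q| ≤ D₁ * w q) (hWM : ∀ q, |W q| ≤ M) (hWWM : ∀ q, |WW q| ≤ M')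
    (hηc0 : 0 ≤ ηc) (hηc : ∀ p j, |(cc p j - c p j) / δ - c₁ p j| ≤ ηc * θ ^ j) (hηd0 : 0 ≤ ηd) (hηd : ∀ q, |vv q - v q| ≤ ηd * w q)
    (hηv0 : 0 ≤ ηv) (hηv : ∀ q, |(vv q - v q) / δ - v₁ q| ≤ ηv * w q) (hηW0 : 0 ≤ ηW) (hηW : ∀ q, |WW q - W q| ≤ ηW) (k : ℕ) :
    |(-∑ p ∈ range k, ∑' j, (cc p j * vv (p + 1 + j) - c p j * v (p + 1 + j)) / δ * WW (p + 1 + j))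
        - (-∑ p ∈ range k, ∑' j, (c₁ p j * v (p + 1 + j) + c p j * v₁ (p + 1 + j)) * W (p + 1 + j))|
      ≤ ((ηc / 2 + C₁ * ηd + Cm * ηv) * M' + (C₁ / 2 + Cm * D₁) * ηW) * S * 1 / (1 - θ) := by
  have hη : 0 ≤ (ηc / 2 + C₁ * ηd + Cm * ηv) * M' + (C₁ / 2 + Cm * D₁) * ηW := by positivity
  have hF := secondIntegrand_sub_abs_le hCm hC₁ hD₁ hθ0 hw0 hc hv hvv hc₁ hv₁ hWWM hηc0 hηc hηd hηv hηW
  have hA : ∀ p, Summable fun j => cc p j * vv (p + 1 + j) * WW (p + 1 + j) := term_summable hCm hθ0 hθ1 hwanti hcc hvv hWWM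
  have hAB : ∀ p, Summable fun j => c p j * v (p + 1 + j) * WW (p + 1 + j) := term_summable hCm hθ0 hθ1 hwanti hc hv hWWM
  have hC : ∀ p, Summable fun j => (cc p j * vv (p + 1 + j) - c p j * v (p + 1 + j)) / δ * WW (p + 1 + j) := fun p =>
    (((hA p).sub (hAB p)).div_const δ).congr fun j => by ring
  have hT : ∀ p, Summable fun j => (c₁ p j * v (p + 1 + j) + c p j * v₁ (p + 1 + j)) * W (p + 1 + j) :=
    secondIntegrand_summable hCm hC₁ hD₁ hθ0 hθ1 hw0 hwanti hc hv hc₁ hv₁ hWM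
  have hk := kernel_abs_le hθ0 hθ1 hw0 hwanti hwS zero_le_one hη hF k
  have e1 : (-∑ p ∈ range k, ∑' j, (cc p j * vv (p + 1 + j) - c p j * v (p + 1 + j)) / δ * WW (p + 1 + j))
        - (-∑ p ∈ range k, ∑' j, (c₁ p j * v (p + 1 + j) + c p j * v₁ (p + 1 + j)) * W (p + 1 + j))
      = -∑ p ∈ range k, ∑' j, ((cc p j * vv (p + 1 + j) - c p j * v (p + 1 + j)) / δ * WW (p + 1 + j)
          - (c₁ p j * v (p + 1 + j) + c p j * v₁ (p + 1 + j)) * W (p + 1 + j)) := by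
    rw [Finset.sum_congr rfl fun p _ => (hC p).tsum_sub (hT p), Finset.sum_sub_distrib]; ring
  rw [e1, abs_neg]
  exact hk

/-! ## §141 The quotient against the derived solution: one `fixedPoint_perturb` -/

/-- **THE SECOND-ORDER PERTURBATION ESTIMATE.**  Two linear memory equations WITH THE SAME SOURCE s — data (c, v) and (c̃, ṽ) under the standing bounds, smallness
`C_mS∕(2(1−θ)) ≤ 1∕2`, bounded solutions W, W̃ (by M, M′) —; derived data `(c₁, v₁)` (`|c₁| ≤ C₁θ^j`, `|v₁| ≤ D₁w`); V a bounded solution of the DERIVED equation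
`V_k = −Σ_{p<k}Σ_j (c₁v + cv₁)_{p,j}W_{p+1+j} − Σ_{p<k}Σ_j c_{p,j}v_{p+1+j}V_{p+1+j}`; a number δ and the four smallnesses of §140.  THEN FOR EVERY k:
**`|(W̃_k − W_k)∕δ − V_k| ≤ (ηS∕(1−θ))∕(1 − C_mS∕(2(1−θ)))`**, `η = (η_c∕2 + C₁η_d + C_mη_v)M′ + (C₁∕2 + C_mD₁)η_W` — §139 puts the quotient and V on the same kernel, §140 makes
their sources `ηS∕(1−θ)`-close, part 66's `fixedPoint_perturb` (with η = 0 there) concludes. [folklore] -/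
theorem secondQuotient_sub_abs_le {Cm C₁ D₁ θ S M M' MV δ ηc ηd ηv ηW : ℝ} {w : ℕ → ℝ} {c cc c₁ : ℕ → ℕ → ℝ} {v vv v₁ s W WW V : ℕ → ℝ}
    (hCm : 0 ≤ Cm) (hC₁ : 0 ≤ C₁) (hD₁ : 0 ≤ D₁) (hθ0 : 0 ≤ θ) (hθ1 : θ < 1)
    (hw0 : ∀ q, 0 ≤ w q) (hwanti : ∀ {a b : ℕ}, a ≤ b → w b ≤ w a) (hwS : ∀ m, ∑ q ∈ range (m + 1), w q ≤ S)
    (hq : Cm * S / (2 * (1 - θ)) ≤ 1 / 2) (hM' : 0 ≤ M')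
    (hc : ∀ p j, |c p j| ≤ Cm * θ ^ j) (hv : ∀ q, |v q| ≤ w q / 2) (hcc : ∀ p j, |cc p j| ≤ Cm * θ ^ j) (hvv : ∀ q, |vv q| ≤ w q / 2)
    (hc₁ : ∀ p j, |c₁ p j| ≤ C₁ * θ ^ j) (hv₁ : ∀ q, |v₁ q| ≤ D₁ * w q)
    (hW : ∀ k, W k = s k - ∑ p ∈ range k, ∑' j, c p j * v (p + 1 + j) * W (p + 1 + j)) (hWM : ∀ q, |W q| ≤ M)
    (hWW : ∀ k, WW k = s k - ∑ p ∈ range k, ∑' j, cc p j * vv (p + 1 + j) * WW (p + 1 + j)) (hWWM : ∀ q, |WW q| ≤ M')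
    (hV : ∀ k, V k = (-∑ p ∈ range k, ∑' j, (c₁ p j * v (p + 1 + j) + c p j * v₁ (p + 1 + j)) * W (p + 1 + j))
      - ∑ p ∈ range k, ∑' j, c p j * v (p + 1 + j) * V (p + 1 + j)) (hVM : ∀ q, |V q| ≤ MV)
    (hηc0 : 0 ≤ ηc) (hηc : ∀ p j, |(cc p j - c p j) / δ - c₁ p j| ≤ ηc * θ ^ j) (hηd0 : 0 ≤ ηd) (hηd : ∀ q, |vv q - v q| ≤ ηd * w q)
    (hηv0 : 0 ≤ ηv) (hηv : ∀ q, |(vv q - v q) / δ - v₁ q| ≤ ηv * w q) (hηW0 : 0 ≤ ηW) (hηW : ∀ q, |WW q - W q| ≤ ηW) (k : ℕ) :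
    |(WW k - W k) / δ - V k|
      ≤ (((ηc / 2 + C₁ * ηd + Cm * ηv) * M' + (C₁ / 2 + Cm * D₁) * ηW) * S * 1 / (1 - θ)) / (1 - Cm * S / (2 * (1 - θ))) := by
  have hQM : ∀ q, |(WW q - W q) / δ| ≤ (M' + M) / |δ| := quotient_bound hWM hWWM
  -- the quotient solves the base equation with the increment source (§139; equal sources cancel)
  have hQ : ∀ k, (fun q => (WW q - W q) / δ) k
      = (fun k => -∑ p ∈ range k, ∑' j, (cc p j * vv (p + 1 + j) - c p j * v (p + 1 + j)) / δ * WW (p + 1 + j)) k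
        - ∑ p ∈ range k, ∑' j, c p j * v (p + 1 + j) * (fun q => (WW q - W q) / δ) (p + 1 + j) := by
    intro k
    have h := secondQuotient_identity (δ := δ) hCm hθ0 hθ1 hwanti hc hv hcc hvv hW hWM hWW hWWM k
    simp only [sub_self, zero_div, zero_sub] at h
    exact h
  have hss : ∀ k, |(fun k => -∑ p ∈ range k, ∑' j, (cc p j * vv (p + 1 + j) - c p j * v (p + 1 + j)) / δ * WW (p + 1 + j)) k
      - (fun k => -∑ p ∈ range k, ∑' j, (c₁ p j * v (p + 1 + j) + c p j * v₁ (p + 1 + j)) * W (p + 1 + j)) k|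
      ≤ ((ηc / 2 + C₁ * ηd + Cm * ηv) * M' + (C₁ / 2 + Cm * D₁) * ηW) * S * 1 / (1 - θ) := fun k =>
    secondSource_sub_abs_le hCm hC₁ hD₁ hθ0 hθ1 hw0 hwanti hwS hM' hc hv hcc hvv hc₁ hv₁ hWM hWWM hηc0 hηc hηd0 hηd hηv0 hηv hηW0 hηW k
  have hE : ∀ p j, |c p j * v (p + 1 + j) - c p j * v (p + 1 + j)| ≤ Cm * θ ^ j * (w (p + 1 + j) * 0) := fun p j => by
    rw [sub_self, abs_zero, mul_zero, mul_zero]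
  have hV' : ∀ k, V k = (fun k => -∑ p ∈ range k, ∑' j, (c₁ p j * v (p + 1 + j) + c p j * v₁ (p + 1 + j)) * W (p + 1 + j)) k
      - ∑ p ∈ range k, ∑' j, c p j * v (p + 1 + j) * V (p + 1 + j) := hV
  have h := fixedPoint_perturb hCm hθ0 hθ1 hw0 hwanti hwS hq hc hv hc hv hQ hQM hV' hVM hss le_rfl hE k
  simpa only [zero_mul, mul_zero, zero_div, add_zero] using h

end

end Summit.QuantumFields.BalabanUV.Beta.EriceFlowEnclosureB12AsPrintedHistoryContagionShiftFlowZeroTangentSecondQuotient
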